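import Literature.NumberTheory.Sieve.CFSemigroupTransferComplex
import Literature.NumberTheory.Sieve.CFSemigroupEigenmeasure
import HarnessLib

/-!
# Aperiodicity of the complex transfer operators of `Γ_A` (the non-lattice property)

Support file (all results proved) for the named fact
`Literature.NumberTheory.Sieve.MageeOhWinter2019_uniformCounting` (`CFSemigroupCounting.lean`).
The renewal theorem behind [MageeOhWinter2019, Thm. 11 / Prop. 17] (Lalley) and the spectral
bound of [MageeOhWinter2019, Thm. 4 (1)] for small `|Im s| ≠ 0` both rest on the fact that on the
critical line `Re s = δ`, `s ≠ δ`, the transfer operator `L_s` has no eigenvalue of modulus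
`e^{P(δ)}` — the **non-lattice** (non-arithmeticity) property of the length spectrum
`{2 log λ(M_w)}` of the continued fractions semigroup ([MageeOhWinter2019, §4.1–4.2], after
Naud, Prop. 21/Lemma 4.2, and Lalley, Thm. 1 hypothesis). We prove it for `Γ_A` in the
following concrete form (`cfLC_eigenfunction_eq_zero`):

  if `A` contains two distinct letters, `σ ≥ 0`, `t ≠ 0`, `|ω| = 1` and `w` is continuous on
  `[0,1]` with `L_{σ+it} w = ω e^{P_A(σ)} w` on `[0,1]`, then `w = 0` on `[0,1]`.

The proof is the classical one:
* `cfLC_eigen_maxPrinciple` (maximum principle / convexity, Naud [14, p. 132]): with the positive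
  eigenfunction `h` of `L_σ`, `|w| ≤ m h` on `[0,1]` with equality on the Cantor set `E_A`
  (domination `‖L_sⁿ w‖ ≤ L_σⁿ ‖w‖`, the maximum of `|w|/h`, and density of `{M_v x₀}` in `E_A`);
* `cfLC_eigen_phase`, `cfLC_eigen_phase_word`, `cfLC_eigen_phase_periodic`: equality in the
  triangle inequality (`eq_of_norm_sum_eq_sum_norm`) aligns the phases:
  `denom(M_v, x_v)^{-2it} = ω^{|v|}` at every periodic point `x_v = M_v x_v ∈ E_A`;
* `cf_nonlattice_core`: for the words `a^k b` (`a ≠ b`), with `λ_k = λ(g_a^k g_b)` and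
  `e = λ(g_a)`, the phases force `log λ_k - k log e` into a translate of `(π/t)ℤ`; this sequence
  is bounded (`cf_twoStep_bounds`), so two values coincide, `λ_{k+m} = e^m λ_k`, and the trace
  recurrence `T_{k+2} = a T_{k+1} + T_k` (from `g_a² = a g_a + 1`) with the Cassini-type
  identity then gives `(a - b)² = 0`, a contradiction.

## References

* M. Magee, H. Oh, D. Winter, J. reine angew. Math. 753 (2019) 89–135, §4.1–4.2 (after Naud).
  [MageeOhWinter2019]
* F. Naud, Ann. Sci. ÉNS 38 (2005) 116–153, Prop. 5.3 / proof of the non-lattice step.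
* S. P. Lalley, Acta Math. 163 (1989) 1–55, §7 (non-lattice hypothesis for Schottky groups).
-/

noncomputable section

open Filter Set
open scoped Topology ComplexConjugate

namespace Literature.NumberTheory.Sieve

variable {A : Finset ℕ} {n : ℕ}

/-! ### The Cantor set: shift identity, invariance, periodic points -/

/-- **Shift identity:** `[0; d] = M_n(d) · [0; σⁿ d]`. [folklore] -/
theorem cfValue_eq_cfMoeb_cfWord {d : ℕ → ℕ} (hd : ∀ i, 1 ≤ d i) (n : ℕ) :
    cfValue d = cfMoeb (cfWord d n) (cfValue fun i => d (i + n)) := by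
  have hd' : ∀ i, 1 ≤ (fun i => d (i + n)) i := fun i => hd (i + n)
  have hconv : ∀ m, cfConv d (m + n) = cfMoeb (cfWord d n) (cfConv (fun i => d (i + n)) m) := by
    intro m
    rw [cfConv_add hd n m, cfMoeb]
    rfl
  have hy₀ : cfValue (fun i => d (i + n)) ∈ Icc (0 : ℝ) 1 := cfValue_mem_Icc hd'
  have hden : 0 < (cfWord d n 1 0 : ℝ) * cfValue (fun i => d (i + n)) + cfWord d n 1 1 := by
    have h10 : (0 : ℝ) ≤ cfWord d n 1 0 := by exact_mod_cast cfWord_nonneg d n 1 0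
    have h11 : (1 : ℝ) ≤ cfWord d n 1 1 := by
      have h := one_le_cfDen hd n
      unfold cfDen at h
      exact_mod_cast h
    nlinarith [hy₀.1]
  have hcont : ContinuousAt (cfMoeb (cfWord d n)) (cfValue fun i => d (i + n)) := by
    unfold cfMoeb
    exact ((continuous_const.mul continuous_id).add continuous_const).continuousAt.div
      ((continuous_const.mul continuous_id).add continuous_const).continuousAt hden.ne'
  have h1 : Tendsto (fun m => cfConv d (m + n)) atTop (𝓝 (cfValue d)) :=
    (tendsto_cfConv_cfValue hd).comp (tendsto_add_atTop_nat n)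
  have h2 : Tendsto (fun m => cfConv d (m + n)) atTop
      (𝓝 (cfMoeb (cfWord d n) (cfValue fun i => d (i + n)))) := by
    simp_rw [hconv]
    exact hcont.tendsto.comp (tendsto_cfConv_cfValue hd')
  exact tendsto_nhds_unique h1 h2

/-- `[0; d] > 0` for digits `≥ 1`. [folklore] -/
theorem cfValue_pos {d : ℕ → ℕ} (hd : ∀ i, 1 ≤ d i) : 0 < cfValue d := by
  have h1 : ∀ m, 1 / ((d 0 : ℝ) + 1) ≤ cfConv d (m + 1) := le_cfConv_succ hd
  have hlim : Tendsto (fun m => cfConv d (m + 1)) atTop (𝓝 (cfValue d)) :=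
    (tendsto_cfConv_cfValue hd).comp (tendsto_add_atTop_nat 1)
  have h2 : 1 / ((d 0 : ℝ) + 1) ≤ cfValue d := ge_of_tendsto' hlim h1
  have h3 : (0 : ℝ) < 1 / ((d 0 : ℝ) + 1) := by positivity
  linarith

/-- Prepending a digit to a digit sequence. [folklore] -/
def cfCons (a : ℕ) (d : ℕ → ℕ) : ℕ → ℕ
  | 0 => a
  | i + 1 => d i

/-- `[0; a, d] = 1/(a + [0; d])`. [folklore] -/
theorem cfValue_cfCons {a : ℕ} (ha : 1 ≤ a) {d : ℕ → ℕ} (hd : ∀ i, 1 ≤ d i) :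
    cfValue (cfCons a d) = 1 / (cfValue d + a) := by
  have hc : ∀ i, 1 ≤ cfCons a d i := fun i => by
    cases i with
    | zero => exact ha
    | succ i => exact hd i
  have h := cfValue_eq_cfMoeb_cfWord hc 1
  have hs : (fun i => cfCons a d (i + 1)) = d := funext fun i => rfl
  rw [hs, cfWord_succ, cfWord_zero, one_mul] at h
  rw [h]
  exact cfMoeb_cfGen a _

/-- **The Cantor set is invariant under the inverse branches:** `x ∈ E_A`, `a ∈ A` imply
`1/(x + a) ∈ E_A`. [folklore] -/
theorem one_div_add_mem_cfCantorSet (hA : ∀ a ∈ A, 1 ≤ a) {x : ℝ} (hx : x ∈ cfCantorSet A)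
    {a : ℕ} (ha : a ∈ A) : 1 / (x + a) ∈ cfCantorSet A := by
  obtain ⟨d, hdA, rfl⟩ := hx
  refine ⟨cfCons a d, fun i => ?_, ?_⟩
  · cases i with
    | zero => exact ha
    | succ i => exact hdA i
  · rw [cfValue_cfCons (hA a ha) fun i => hA _ (hdA i)]

/-- **Fixed points give eigenvalues:** if `M x = x` then `λ = denom(M, x)` satisfies
`λ² - tr(M) λ + det M = 0` (`(x, 1)` is an eigenvector of `M`). [folklore] -/
theorem cfDenom_sq_sub_of_fixed (M : Matrix (Fin 2) (Fin 2) ℤ) {x : ℝ} (hden : cfDenom M x ≠ 0)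
    (hfix : cfMoeb M x = x) :
    cfDenom M x ^ 2 - ((M 0 0 : ℝ) + M 1 1) * cfDenom M x +
      ((M 0 0 : ℝ) * M 1 1 - (M 0 1 : ℝ) * M 1 0) = 0 := by
  unfold cfMoeb at hfix
  unfold cfDenom at hden ⊢
  rw [div_eq_iff hden] at hfix
  linear_combination (-(M 1 0 : ℝ)) * hfix

/-! ### Equality in the triangle inequality -/

/-- **Equality in the triangle inequality for finite sums in `ℂ`:** if `‖Σ zᵢ‖ = Σ ‖zᵢ‖` then every
`zᵢ` is a nonnegative multiple of the sum: `zᵢ ‖S‖ = ‖zᵢ‖ S`. [folklore] -/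
theorem eq_of_norm_sum_eq_sum_norm {ι : Type*} (s : Finset ι) (z : ι → ℂ)
    (hS : ‖∑ i ∈ s, z i‖ = ∑ i ∈ s, ‖z i‖) {i : ι} (hi : i ∈ s) :
    z i * (‖∑ j ∈ s, z j‖ : ℂ) = (‖z i‖ : ℂ) * ∑ j ∈ s, z j := by
  set S := ∑ j ∈ s, z j with hSdef
  have hle : ∀ j ∈ s, (z j * conj S).re ≤ ‖z j‖ * ‖S‖ := fun j _ =>
    (Complex.re_le_norm _).trans (by rw [norm_mul, Complex.norm_conj])
  have hsum : ∑ j ∈ s, (z j * conj S).re = ∑ j ∈ s, ‖z j‖ * ‖S‖ := by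
    rw [← Finset.sum_mul, ← hS, ← Complex.re_sum, ← Finset.sum_mul]
    change (S * conj S).re = ‖S‖ * ‖S‖
    rw [Complex.mul_conj', sq, ← Complex.ofReal_mul, Complex.ofReal_re]
  have heq := (Finset.sum_eq_sum_iff_of_le hle).1 hsum i hi
  have hn : ‖z i * conj S‖ = ‖z i‖ * ‖S‖ := by rw [norm_mul, Complex.norm_conj]
  have hreal : z i * conj S = ((‖z i‖ * ‖S‖ : ℝ) : ℂ) := by
    apply Complex.ext
    · simpa using heq
    · have hre : (z i * conj S).re = ‖z i * conj S‖ := by rw [hn]; exact heq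
      have h3 : (z i * conj S).im * (z i * conj S).im = 0 := by
        have h4 := Complex.normSq_apply (z i * conj S)
        rw [Complex.normSq_eq_norm_sq, ← hre, sq] at h4
        linarith
      simpa using mul_self_eq_zero.1 h3
  by_cases hS0 : S = 0
  · simp [hS0]
  · have hnS : (‖S‖ : ℂ) ≠ 0 := by exact_mod_cast norm_ne_zero_iff.2 hS0
    have key : z i * (‖S‖ : ℂ) * (‖S‖ : ℂ) = (‖z i‖ : ℂ) * S * (‖S‖ : ℂ) := by
      calc z i * (‖S‖ : ℂ) * (‖S‖ : ℂ) = z i * (conj S * S) := by rw [Complex.conj_mul', sq]; ring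
        _ = (z i * conj S) * S := by ring
        _ = ((‖z i‖ * ‖S‖ : ℝ) : ℂ) * S := by rw [hreal]
        _ = (‖z i‖ : ℂ) * S * (‖S‖ : ℂ) := by push_cast; ring
    exact mul_right_cancel₀ hnS key

/-! ### Complex weights: unimodular part -/

/-- Additivity of the weights in `s`: `wt_{s₁+s₂} = wt_{s₁} wt_{s₂}`. [folklore] -/
theorem cfWt_add (s₁ s₂ : ℂ) (M : Matrix (Fin 2) (Fin 2) ℤ) (x : ℝ) :
    cfWt (s₁ + s₂) M x = cfWt s₁ M x * cfWt s₂ M x := by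
  rw [cfWt, cfWt, cfWt, ← Complex.exp_add]
  congr 1
  ring

/-- The real part of `σ + it`. [folklore] -/
theorem re_ofReal_add_mul_I (σ t : ℝ) : ((σ : ℂ) + t * Complex.I).re = σ := by simp

/-! ### Iterating the complex eigen-equation -/

/-- Iterating `L_s w = c w` on `[0,1]`: `L_sⁿ w = cⁿ w` on `[0,1]`. [folklore] -/
theorem cfLC_iterate_of_eigen (hA : ∀ a ∈ A, 1 ≤ a) {s c : ℂ} {w : ℝ → ℂ}
    (heig : ∀ x ∈ Icc (0 : ℝ) 1, cfLC A s w x = c * w x) :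
    ∀ (n : ℕ) {x : ℝ}, x ∈ Icc (0 : ℝ) 1 → (cfLC A s)^[n] w x = c ^ n * w x
  | 0, x, _ => by simp
  | n + 1, x, hx => by
      rw [Function.iterate_succ_apply', cfLC, pow_succ]
      have hrec : ∀ a ∈ A, (cfLC A s)^[n] w (1 / (x + a)) = c ^ n * w (1 / (x + a)) :=
        fun a ha => cfLC_iterate_of_eigen hA heig n (one_div_add_mem_Icc (hA a ha) hx)
      rw [Finset.sum_congr rfl fun a ha => by rw [hrec a ha]]
      have hL := heig x hx
      rw [cfLC] at hL
      calc ∑ a ∈ A, cfWt s (cfGen a) x * (c ^ n * w (1 / (x + a)))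
          = c ^ n * ∑ a ∈ A, cfWt s (cfGen a) x * w (1 / (x + a)) := by
            rw [Finset.mul_sum]
            exact Finset.sum_congr rfl fun a _ => by ring
        _ = c ^ n * c * w x := by rw [hL]; ring

/-! ### The maximum principle: `|w| = m h` on the Cantor set -/

section MaxPrinciple

variable (hA : ∀ a ∈ A, 1 ≤ a)
include hA

/-- **Maximum principle** (convexity argument, Naud [14, p. 132]): if `L_s w = ω e^{P_A(σ)} w` on
`[0,1]` with `Re s = σ`, `|ω| = 1`, `w` continuous, and `h > 0` is the eigenfunction of `L_σ`, then
with `m = max |w|/h` one has `|w| ≤ m h` on `[0,1]` and `|w| = m h` on the Cantor set `E_A`.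
[cite: MageeOhWinter2019, §4.2] -/
theorem cfLC_eigen_maxPrinciple {σ : ℝ} {s : ℂ} (hs : s.re = σ)
    {h : ℝ → ℝ} (hpos : ∀ x ∈ Icc (0 : ℝ) 1, 0 < h x) (hcont : ContinuousOn h (Icc 0 1))
    (heigh : ∀ x ∈ Icc (0 : ℝ) 1, cfTransfer A σ h x = cfEig A σ * h x)
    {w : ℝ → ℂ} (hw : ContinuousOn w (Icc 0 1)) {ω : ℂ} (hω : ‖ω‖ = 1)
    (heig : ∀ x ∈ Icc (0 : ℝ) 1, cfLC A s w x = ω * (cfEig A σ : ℂ) * w x) :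
    ∃ m : ℝ, 0 ≤ m ∧ (∀ x ∈ Icc (0 : ℝ) 1, ‖w x‖ ≤ m * h x) ∧
      ∀ x ∈ cfCantorSet A, ‖w x‖ = m * h x := by
  have hlam : 0 < cfEig A σ := cfEig_pos σ
  -- `u = |w|`, the maximum of `u/h`
  have hucont : ContinuousOn (fun x => ‖w x‖) (Icc 0 1) := hw.norm
  have hratio : ContinuousOn (fun x => ‖w x‖ / h x) (Icc 0 1) :=
    hucont.div hcont fun x hx => (hpos x hx).ne'
  obtain ⟨x₀, hx₀, hmax⟩ := isCompact_Icc.exists_isMaxOn (nonempty_Icc.2 zero_le_one) hratio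
  have hm0 : 0 ≤ ‖w x₀‖ / h x₀ := div_nonneg (norm_nonneg _) (hpos x₀ hx₀).le
  have hle : ∀ x ∈ Icc (0 : ℝ) 1, ‖w x‖ ≤ ‖w x₀‖ / h x₀ * h x := by
    intro x hx
    have h1 : ‖w x‖ / h x ≤ ‖w x₀‖ / h x₀ := isMaxOn_iff.1 hmax x hx
    rwa [div_le_iff₀ (hpos x hx)] at h1
  refine ⟨‖w x₀‖ / h x₀, hm0, hle, ?_⟩
  set m : ℝ := ‖w x₀‖ / h x₀ with hm
  have h5 : m * h x₀ = ‖w x₀‖ := by rw [hm, div_mul_cancel₀ _ (hpos x₀ hx₀).ne']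
  -- `g = m h - u ≥ 0`, and `L_σⁿ g (x₀) = 0`
  set g : ℝ → ℝ := fun x => m * h x - ‖w x‖ with hg
  have hg0 : ∀ x ∈ Icc (0 : ℝ) 1, 0 ≤ g x := fun x hx => by
    simp only [hg]; linarith [hle x hx]
  have hdom : ∀ n, cfEig A σ ^ n * ‖w x₀‖ ≤ (cfTransfer A σ)^[n] (fun x => ‖w x‖) x₀ := by
    intro n
    have h1 := norm_cfLC_iterate_le hA s n w hx₀
    rw [cfLC_iterate_of_eigen hA heig n hx₀, hs] at h1
    have hn : ‖(ω * (cfEig A σ : ℂ)) ^ n * w x₀‖ = cfEig A σ ^ n * ‖w x₀‖ := by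
      rw [norm_mul, norm_pow, norm_mul, hω, one_mul, Complex.norm_real, Real.norm_eq_abs,
        abs_of_pos hlam]
    rwa [hn] at h1
  have hLg : ∀ n, (cfTransfer A σ)^[n] g x₀ = 0 := by
    intro n
    have hsplit : ∀ y ∈ Icc (0 : ℝ) 1, g y = (fun y => m * h y + (-1) * ‖w y‖) y :=
      fun y _ => by simp only [hg]; ring
    have h2 : (cfTransfer A σ)^[n] g x₀ =
        m * (cfEig A σ ^ n * h x₀) - (cfTransfer A σ)^[n] (fun x => ‖w x‖) x₀ := by
      rw [cfTransfer_iterate_congr hA σ n hsplit hx₀,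
        cfTransfer_iterate_add hA σ n (fun y => m * h y) (fun y => (-1) * ‖w y‖) hx₀,
        cfTransfer_iterate_const_mul hA σ n m h hx₀,
        cfTransfer_iterate_const_mul hA σ n (-1) (fun y => ‖w y‖) hx₀,
        cfTransfer_iterate_of_eigen hA heigh n hx₀]
      ring
    have h3 : 0 ≤ (cfTransfer A σ)^[n] g x₀ := cfTransfer_iterate_nonneg hA σ n hg0 hx₀
    have h4 := hdom n
    have h6 : m * (cfEig A σ ^ n * h x₀) = cfEig A σ ^ n * ‖w x₀‖ := by rw [← h5]; ring
    have h7 : (cfTransfer A σ)^[n] g x₀ ≤ 0 := by rw [h2, h6]; linarith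
    linarith
  -- every word: `g (M_v x₀) = 0`
  have hterm : ∀ (n : ℕ) (v : Fin n → A), g (cfMoeb (cfMat fun i => (v i : ℕ)) x₀) = 0 := by
    intro n v
    have h1 := hLg n
    rw [cfTransfer_iterate hA σ g n hx₀, cfTransferSum] at h1
    have hnn : ∀ w' ∈ (Finset.univ : Finset (Fin n → A)),
        0 ≤ ((cfDenom (cfMat fun i => (w' i : ℕ)) x₀) ^ 2) ^ (-σ) *
          g (cfMoeb (cfMat fun i => (w' i : ℕ)) x₀) :=
      fun w' _ => mul_nonneg (Real.rpow_nonneg (sq_nonneg _) _)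
        (hg0 _ (cfMoeb_cfMat_mem (one_le_coe_digit hA w') hx₀))
    have h2 := (Finset.sum_eq_zero_iff_of_nonneg hnn).1 h1 v (Finset.mem_univ _)
    have hwt : 0 < ((cfDenom (cfMat fun i => (v i : ℕ)) x₀) ^ 2) ^ (-σ) :=
      Real.rpow_pos_of_pos (pow_pos (cfDenom_cfMat_pos (one_le_coe_digit hA v) hx₀) 2) _
    rcases mul_eq_zero.1 h2 with h' | h'
    · exact absurd h' hwt.ne'
    · exact h'
  -- pass to the Cantor set
  intro e he
  obtain ⟨d, hdA, rfl⟩ := he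
  have hd : ∀ i, 1 ≤ d i := fun i => hA _ (hdA i)
  have hgcont : ContinuousOn g (Icc 0 1) := by
    simp only [hg]
    exact (continuousOn_const.mul hcont).sub hucont
  have hyI : ∀ k, cfMoeb (cfWord d k) x₀ ∈ Icc (0 : ℝ) 1 := fun k => by
    have hmat : cfMat (fun i : Fin k => d i) = cfWord d k :=
      cfWord_congr fun i hi => by rw [cfExt_of_lt _ hi]
    rw [← hmat]
    exact cfMoeb_cfMat_mem (fun i => hd i) hx₀
  have hy0 : ∀ k, g (cfMoeb (cfWord d k) x₀) = 0 := fun k => by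
    have hmat : cfMat (fun i : Fin k => (((⟨d i, hdA i⟩ : A) : A) : ℕ)) = cfWord d k :=
      cfWord_congr fun i hi => by rw [cfExt_of_lt _ hi]
    have := hterm k fun i => ⟨d i, hdA i⟩
    rwa [hmat] at this
  have hylim : Tendsto (fun k => cfMoeb (cfWord d k) x₀) atTop (𝓝 (cfValue d)) := by
    have hb : ∀ k, |cfMoeb (cfWord d k) x₀ - cfValue d| ≤ 4 * (1 / 2 : ℝ) ^ k := fun k =>
      (abs_cfMoeb_sub_cfValue_le hd k hx₀).trans (two_div_cfDen_sq_le hA hd k)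
    have h0 : Tendsto (fun k => 4 * (1 / 2 : ℝ) ^ k) atTop (𝓝 0) := by
      have := (tendsto_pow_atTop_nhds_zero_of_lt_one (by norm_num : (0 : ℝ) ≤ 1 / 2)
        (by norm_num)).const_mul (4 : ℝ)
      simpa using this
    rw [tendsto_iff_norm_sub_tendsto_zero]
    exact squeeze_zero (fun k => norm_nonneg _) (fun k => by rw [Real.norm_eq_abs]; exact hb k) h0
  have hcv : cfValue d ∈ Icc (0 : ℝ) 1 := cfValue_mem_Icc hd
  have hglim : Tendsto (fun k => g (cfMoeb (cfWord d k) x₀)) atTop (𝓝 (g (cfValue d))) :=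
    (hgcont (cfValue d) hcv).tendsto.comp
      (tendsto_nhdsWithin_of_tendsto_nhds_of_eventually_within _ hylim (Eventually.of_forall hyI))
  have hg_e : g (cfValue d) = 0 := by
    have hz : Tendsto (fun k => g (cfMoeb (cfWord d k) x₀)) atTop (𝓝 0) := by
      simp_rw [hy0]; exact tendsto_const_nhds
    exact tendsto_nhds_unique hglim hz
  simp only [hg] at hg_e
  linarith

end MaxPrinciple

/-! ### Phase alignment on the Cantor set -/

section Phase

variable (hA : ∀ a ∈ A, 1 ≤ a) {σ t : ℝ} {h : ℝ → ℝ} (hpos : ∀ x ∈ Icc (0 : ℝ) 1, 0 < h x)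
  (heigh : ∀ x ∈ Icc (0 : ℝ) 1, cfTransfer A σ h x = cfEig A σ * h x)
  {w : ℝ → ℂ} {ω : ℂ} (hω : ‖ω‖ = 1)
  (heig : ∀ x ∈ Icc (0 : ℝ) 1,
    cfLC A ((σ : ℂ) + t * Complex.I) w x = ω * (cfEig A σ : ℂ) * w x)
  {m : ℝ} (hm : 0 < m) (hE : ∀ x ∈ cfCantorSet A, ‖w x‖ = m * h x)
include hA hpos heigh hω heig hm hE

omit hpos hm in
/-- **Phase alignment** (equality case of the triangle inequality): on the Cantor set,
`(x+a)^{-2it} w(g_a x) |w(x)| = ω w(x) |w(g_a x)|` for every `a ∈ A`.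
[cite: MageeOhWinter2019, §4.2] -/
theorem cfLC_eigen_phase {x : ℝ} (hx : x ∈ cfCantorSet A) {a : ℕ} (ha : a ∈ A) :
    cfWt (t * Complex.I) (cfGen a) x * w (1 / (x + a)) * (‖w x‖ : ℂ) =
      ω * w x * (‖w (1 / (x + a))‖ : ℂ) := by
  have hxI : x ∈ Icc (0 : ℝ) 1 := cfCantorSet_subset_Icc hA hx
  have hlam : 0 < cfEig A σ := cfEig_pos σ
  have hre := re_ofReal_add_mul_I σ t
  set z : ℕ → ℂ := fun b => cfWt ((σ : ℂ) + t * Complex.I) (cfGen b) x * w (1 / (x + b)) with hz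
  have hS : ∑ b ∈ A, z b = ω * (cfEig A σ : ℂ) * w x := by rw [← heig x hxI]; rfl
  have hden : ∀ b ∈ A, 0 < cfDenom (cfGen b) x := fun b hb => by
    rw [cfDenom_cfGen]
    have : (1 : ℝ) ≤ b := by exact_mod_cast hA b hb
    linarith [hxI.1]
  have hnz : ∀ b ∈ A, ‖z b‖ = ((x + b) ^ 2) ^ (-σ) * (m * h (1 / (x + b))) := by
    intro b hb
    simp only [hz]
    rw [norm_mul, norm_cfWt _ _ (hden b hb), cfDenom_cfGen, hre,
      hE _ (one_div_add_mem_cfCantorSet hA hx hb)]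
  have hsumnorm : ∑ b ∈ A, ‖z b‖ = m * (cfEig A σ * h x) := by
    rw [Finset.sum_congr rfl hnz, ← heigh x hxI, cfTransfer, Finset.mul_sum]
    exact Finset.sum_congr rfl fun b _ => by ring
  have hnormS : ‖∑ b ∈ A, z b‖ = ∑ b ∈ A, ‖z b‖ := by
    rw [hS, hsumnorm, norm_mul, norm_mul, hω, one_mul, Complex.norm_real, Real.norm_eq_abs,
      abs_of_pos hlam, hE x hx]
    ring
  have key := eq_of_norm_sum_eq_sum_norm A z hnormS ha
  rw [hS] at key
  have hnS : (‖ω * (cfEig A σ : ℂ) * w x‖ : ℂ) = (cfEig A σ : ℂ) * (‖w x‖ : ℂ) := by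
    rw [norm_mul, norm_mul, hω, one_mul, Complex.norm_real, Real.norm_eq_abs, abs_of_pos hlam]
    push_cast
    ring
  have hza : (‖z a‖ : ℂ) = cfWt (σ : ℂ) (cfGen a) x * (‖w (1 / (x + a))‖ : ℂ) := by
    simp only [hz]
    rw [norm_mul, norm_cfWt _ _ (hden a ha), hre, cfWt_ofReal σ _ (hden a ha)]
    push_cast
    ring
  have hzsplit : z a = cfWt (σ : ℂ) (cfGen a) x *
      (cfWt (t * Complex.I) (cfGen a) x * w (1 / (x + a))) := by
    simp only [hz]
    rw [cfWt_add]
    ring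
  rw [hnS, hza, hzsplit] at key
  have hwσ : cfWt (σ : ℂ) (cfGen a) x ≠ 0 := Complex.exp_ne_zero _
  have hlamC : (cfEig A σ : ℂ) ≠ 0 := by exact_mod_cast hlam.ne'
  have key2 : (cfWt (σ : ℂ) (cfGen a) x * (cfEig A σ : ℂ)) *
        (cfWt (t * Complex.I) (cfGen a) x * w (1 / (x + a)) * (‖w x‖ : ℂ)) =
      (cfWt (σ : ℂ) (cfGen a) x * (cfEig A σ : ℂ)) * (ω * w x * (‖w (1 / (x + a))‖ : ℂ)) := by
    calc (cfWt (σ : ℂ) (cfGen a) x * (cfEig A σ : ℂ)) *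
          (cfWt (t * Complex.I) (cfGen a) x * w (1 / (x + a)) * (‖w x‖ : ℂ))
        = cfWt (σ : ℂ) (cfGen a) x * (cfWt (t * Complex.I) (cfGen a) x * w (1 / (x + a))) *
            ((cfEig A σ : ℂ) * (‖w x‖ : ℂ)) := by ring
      _ = cfWt (σ : ℂ) (cfGen a) x * (‖w (1 / (x + a))‖ : ℂ) * (ω * (cfEig A σ : ℂ) * w x) := key
      _ = _ := by ring
  exact mul_left_cancel₀ (mul_ne_zero hwσ hlamC) key2

/-- **Phase alignment along words:** for a digit sequence `d` in `A` and `x ∈ E_A`,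
`denom(M_n(d), x)^{-2it} w(M_n(d) x) |w(x)| = ωⁿ w(x) |w(M_n(d) x)|`.
[cite: MageeOhWinter2019, §4.2] -/
theorem cfLC_eigen_phase_word {d : ℕ → ℕ} (hd : ∀ i, d i ∈ A) :
    ∀ (n : ℕ) {x : ℝ}, x ∈ cfCantorSet A →
      cfWt (t * Complex.I) (cfWord d n) x * w (cfMoeb (cfWord d n) x) * (‖w x‖ : ℂ) =
        ω ^ n * w x * (‖w (cfMoeb (cfWord d n) x)‖ : ℂ)
  | 0, x, _ => by simp [cfWt, cfDenom, cfMoeb]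
  | n + 1, x, hx => by
      have hxI : x ∈ Icc (0 : ℝ) 1 := cfCantorSet_subset_Icc hA hx
      have hd1 : ∀ i, 1 ≤ d i := fun i => hA _ (hd i)
      rw [cfWord_succ]
      have hc : 0 < cfDenom (cfGen (d n)) x := by
        rw [cfDenom_cfGen]
        have : (1 : ℝ) ≤ d n := by exact_mod_cast hd1 n
        linarith [hxI.1]
      have hy' : cfMoeb (cfGen (d n)) x = 1 / (x + d n) := cfMoeb_cfGen _ _
      have hyE : cfMoeb (cfGen (d n)) x ∈ cfCantorSet A := by
        rw [hy']; exact one_div_add_mem_cfCantorSet hA hx (hd n)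
      have hyI : cfMoeb (cfGen (d n)) x ∈ Icc (0 : ℝ) 1 := cfCantorSet_subset_Icc hA hyE
      have hM : 0 < cfDenom (cfWord d n) (cfMoeb (cfGen (d n)) x) := by
        have hmat : cfMat (fun i : Fin n => d i) = cfWord d n :=
          cfWord_congr fun i hi => by rw [cfExt_of_lt _ hi]
        rw [← hmat]
        exact cfDenom_cfMat_pos (fun i => hd1 i) hyI
      rw [cfWt_mul _ _ _ hc hM, cfMoeb_mul _ _ hc.ne' hM.ne']
      have IH := cfLC_eigen_phase_word hd n hyE
      have h1 := cfLC_eigen_phase hA heigh hω heig hE hx (hd n)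
      rw [← hy'] at h1
      set y := cfMoeb (cfGen (d n)) x with hy
      have huy : (‖w y‖ : ℂ) ≠ 0 := by
        have h2 := hE y hyE
        have hpy := hpos y hyI
        have h3 : ‖w y‖ ≠ 0 := by rw [h2]; positivity
        exact_mod_cast h3
      apply mul_right_cancel₀ huy
      calc cfWt (t * Complex.I) (cfGen (d n)) x * cfWt (t * Complex.I) (cfWord d n) y *
            w (cfMoeb (cfWord d n) y) * (‖w x‖ : ℂ) * (‖w y‖ : ℂ)
          = cfWt (t * Complex.I) (cfGen (d n)) x * (‖w x‖ : ℂ) *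
              (cfWt (t * Complex.I) (cfWord d n) y * w (cfMoeb (cfWord d n) y) * (‖w y‖ : ℂ)) := by
            ring
        _ = cfWt (t * Complex.I) (cfGen (d n)) x * (‖w x‖ : ℂ) *
              (ω ^ n * w y * (‖w (cfMoeb (cfWord d n) y)‖ : ℂ)) := by rw [IH]
        _ = ω ^ n * (‖w (cfMoeb (cfWord d n) y)‖ : ℂ) *
              (cfWt (t * Complex.I) (cfGen (d n)) x * w y * (‖w x‖ : ℂ)) := by ring
        _ = ω ^ n * (‖w (cfMoeb (cfWord d n) y)‖ : ℂ) * (ω * w x * (‖w y‖ : ℂ)) := by rw [h1]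
        _ = ω ^ (n + 1) * w x * (‖w (cfMoeb (cfWord d n) y)‖ : ℂ) * (‖w y‖ : ℂ) := by ring

/-- **Phases at periodic points:** if `x = [0; d]` is fixed by `M_n(d)` (e.g. `d` is `n`-periodic)
then `denom(M_n(d), x)^{-2it} = ωⁿ`, i.e. `exp(-2it log λ(M_n(d))) = ωⁿ`.
[cite: MageeOhWinter2019, §4.2] -/
theorem cfLC_eigen_phase_periodic {d : ℕ → ℕ} (hd : ∀ i, d i ∈ A) {n : ℕ} {x : ℝ}
    (hx : x = cfValue d) (hfix : cfMoeb (cfWord d n) x = x) :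
    cfWt (t * Complex.I) (cfWord d n) x = ω ^ n := by
  have hxE : x ∈ cfCantorSet A := ⟨d, hd, hx⟩
  have hxI : x ∈ Icc (0 : ℝ) 1 := cfCantorSet_subset_Icc hA hxE
  have h1 := cfLC_eigen_phase_word hA hpos heigh hω heig hm hE hd n hxE
  rw [hfix] at h1
  have hux' : ‖w x‖ ≠ 0 := by rw [hE x hxE]; have := hpos x hxI; positivity
  have hux : (‖w x‖ : ℂ) ≠ 0 := by exact_mod_cast hux'
  have hwx : w x ≠ 0 := norm_ne_zero_iff.1 hux'
  have h2 := mul_right_cancel₀ hux h1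
  exact mul_right_cancel₀ hwx h2

end Phase

/-! ### The algebraic core of the non-lattice property -/

/-- **Growth of two-step recurrences:** if `Q_{k+2} = a Q_{k+1} + Q_k` with `Q_0, Q_1 > 0` and
`e > 0`, `e² = a e + 1`, then `c eᵏ ≤ Q_k ≤ C eᵏ` for all `k`. [folklore] -/
theorem cf_twoStep_bounds {a : ℕ} {e : ℝ} (he : 0 < e) (hee : e ^ 2 = a * e + 1) {Q : ℕ → ℝ}
    (hrec : ∀ k, Q (k + 2) = a * Q (k + 1) + Q k) (hQ0 : 0 < Q 0) (hQ1 : 0 < Q 1) :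
    ∃ c C : ℝ, 0 < c ∧ 0 < C ∧ ∀ k, c * e ^ k ≤ Q k ∧ Q k ≤ C * e ^ k := by
  refine ⟨min (Q 0) (Q 1 / e), max (Q 0) (Q 1 / e), lt_min hQ0 (div_pos hQ1 he),
    lt_max_of_lt_left hQ0, ?_⟩
  set c := min (Q 0) (Q 1 / e) with hc
  set C := max (Q 0) (Q 1 / e) with hC
  have ha : (0 : ℝ) ≤ a := Nat.cast_nonneg a
  -- two-step induction on the pair `(k, k+1)`
  have key : ∀ k, (c * e ^ k ≤ Q k ∧ Q k ≤ C * e ^ k) ∧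
      (c * e ^ (k + 1) ≤ Q (k + 1) ∧ Q (k + 1) ≤ C * e ^ (k + 1)) := by
    intro k
    induction k with
    | zero =>
        refine ⟨⟨by simp [hc], by simp [hC]⟩, ?_, ?_⟩
        · have h1 : c ≤ Q 1 / e := min_le_right _ _
          rw [le_div_iff₀ he] at h1
          simpa using h1
        · have h1 : Q 1 / e ≤ C := le_max_right _ _
          rw [div_le_iff₀ he] at h1
          simpa using h1
    | succ k ih =>
        refine ⟨ih.2, ?_, ?_⟩
        · have h1 := ih.1.1
          have h2 := ih.2.1
          calc c * e ^ (k + 1 + 1) = c * e ^ k * e ^ 2 := by ring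
            _ = c * e ^ k * (a * e + 1) := by rw [hee]
            _ = a * (c * e ^ (k + 1)) + c * e ^ k := by ring
            _ ≤ a * Q (k + 1) + Q k := by gcongr
            _ = Q (k + 1 + 1) := (hrec k).symm
        · have h1 := ih.1.2
          have h2 := ih.2.2
          calc Q (k + 1 + 1) = a * Q (k + 1) + Q k := hrec k
            _ ≤ a * (C * e ^ (k + 1)) + C * e ^ k := by gcongr
            _ = C * e ^ k * (a * e + 1) := by ring
            _ = C * e ^ k * e ^ 2 := by rw [hee]
            _ = C * e ^ (k + 1 + 1) := by ring
  exact fun k => (key k).1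

/-- **The algebraic core of the non-lattice property:** let `e > 1` with `e² = a e + 1`, let
`T_k` satisfy `T_0 = b`, `T_1 = ab + 2`, `T_{k+2} = a T_{k+1} + T_k` (the traces of
`g_a^k g_b`), and let `λ_k` satisfy `λ_k (T_k - λ_k) = (-1)^{k+1}` (the eigenvalue equation,
`det = (-1)^{k+1}`). If `λ_{k+m} = e^m λ_k` for some `k` and `m ≥ 1`, then `a = b`. [folklore] -/
theorem cf_nonlattice_core {a b : ℕ} {e : ℝ} (he1 : 1 < e) (hee : e ^ 2 = a * e + 1)
    {T : ℕ → ℝ} (hT0 : T 0 = b) (hT1 : T 1 = a * b + 2)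
    (hTrec : ∀ k, T (k + 2) = a * T (k + 1) + T k)
    {lam : ℕ → ℝ} (hquad : ∀ k, lam k * (T k - lam k) = (-1) ^ (k + 1))
    {k m : ℕ} (hm : 1 ≤ m) (hrel : lam (k + m) = e ^ m * lam k) : a = b := by
  have he0 : 0 < e := by linarith
  set E' : ℝ := -1 / e with hE'
  have hprod : e * E' = -1 := by rw [hE']; field_simp
  have hsum : e + E' = a := by
    have h1 : e * (e + E') = e * a := by linear_combination hee + hprod
    exact mul_left_cancel₀ he0.ne' h1
  have hE'2 : E' ^ 2 = a * E' + 1 := by linear_combination E' * hsum - hprod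
  set D : ℝ := e - E' with hD
  set α' : ℝ := T 1 - E' * T 0 with hα'
  set β' : ℝ := e * T 0 - T 1 with hβ'
  -- closed form `D T_j = α' e^j + β' E'^j`
  have hclosed : ∀ j, (D * T j = α' * e ^ j + β' * E' ^ j) ∧
      (D * T (j + 1) = α' * e ^ (j + 1) + β' * E' ^ (j + 1)) := by
    intro j
    induction j with
    | zero =>
        constructor
        · simp only [hD, hα', hβ', pow_zero]; ring
        · simp only [hD, hα', hβ', pow_one, zero_add]; ring
    | succ j ih =>
        refine ⟨ih.2, ?_⟩
        have h1 := ih.1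
        have h2 := ih.2
        calc D * T (j + 1 + 1) = D * (a * T (j + 1) + T j) := by rw [hTrec j]
          _ = a * (D * T (j + 1)) + D * T j := by ring
          _ = a * (α' * e ^ (j + 1) + β' * E' ^ (j + 1)) + (α' * e ^ j + β' * E' ^ j) := by
              rw [h1, h2]
          _ = α' * e ^ j * (a * e + 1) + β' * E' ^ j * (a * E' + 1) := by ring
          _ = α' * e ^ j * e ^ 2 + β' * E' ^ j * E' ^ 2 := by rw [hee, hE'2]
          _ = α' * e ^ (j + 1 + 1) + β' * E' ^ (j + 1 + 1) := by ring
  -- `μ_j = T_j - λ_j`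
  have hlamk : lam k ≠ 0 := by
    intro h0
    have h1 := hquad k
    rw [h0, zero_mul] at h1
    exact absurd h1.symm (pow_ne_zero _ (by norm_num))
  have hem : e ^ m ≠ 0 := pow_ne_zero _ he0.ne'
  have hE'm : E' ^ m * e ^ m = (-1) ^ m := by rw [← mul_pow, mul_comm, hprod]
  have hμ' : T (k + m) - lam (k + m) = E' ^ m * (T k - lam k) := by
    have h1 := hquad (k + m)
    have h2 := hquad k
    apply mul_left_cancel₀ (mul_ne_zero hem hlamk)
    calc e ^ m * lam k * (T (k + m) - lam (k + m)) = lam (k + m) * (T (k + m) - lam (k + m)) := by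
          rw [hrel]
      _ = (-1) ^ (k + m + 1) := h1
      _ = (-1) ^ m * (-1) ^ (k + 1) := by rw [← pow_add]; congr 1; ring
      _ = (E' ^ m * e ^ m) * (lam k * (T k - lam k)) := by rw [hE'm, h2]
      _ = e ^ m * lam k * (E' ^ m * (T k - lam k)) := by ring
  have hTk : D * T k = α' * e ^ k + β' * E' ^ k := (hclosed k).1
  have hTkm : D * T (k + m) = α' * e ^ (k + m) + β' * E' ^ (k + m) := (hclosed (k + m)).1
  have hTkm' : T (k + m) = e ^ m * lam k + E' ^ m * (T k - lam k) := by
    have h1 : T (k + m) = lam (k + m) + (T (k + m) - lam (k + m)) := by ring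
    rw [h1, hμ', hrel]
  -- `p' + q' = 0`, `e^m p' + E'^m q' = 0`
  have eq1 : (D * lam k - α' * e ^ k) + (D * (T k - lam k) - β' * E' ^ k) = 0 := by linarith
  have eq2 : e ^ m * (D * lam k - α' * e ^ k) + E' ^ m * (D * (T k - lam k) - β' * E' ^ k) = 0 := by
    rw [hTkm', pow_add, pow_add] at hTkm
    linarith
  have hne : e ^ m - E' ^ m ≠ 0 := by
    have h1 : 1 < e ^ m := one_lt_pow₀ he1 (by omega)
    have h2 : |E'| < 1 := by
      rw [hE', abs_div, abs_neg, abs_one, abs_of_pos he0, div_lt_one he0]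
      exact he1
    have h3 : |E' ^ m| < 1 := by rw [abs_pow]; exact pow_lt_one₀ (abs_nonneg _) h2 (by omega)
    have h4 : E' ^ m < 1 := (le_abs_self _).trans_lt h3
    linarith
  have hp : (e ^ m - E' ^ m) * (D * lam k - α' * e ^ k) = 0 := by
    have h1 : D * (T k - lam k) - β' * E' ^ k = -(D * lam k - α' * e ^ k) := by linarith
    rw [h1] at eq2
    linarith
  have hlamclosed : D * lam k = α' * e ^ k := by
    rcases mul_eq_zero.1 hp with h1 | h1
    · exact absurd h1 hne
    · linarith
  have hμclosed : D * (T k - lam k) = β' * E' ^ k := by linarith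
  -- the product: `α' β' = -D²`
  have hαβ : α' * β' = -D ^ 2 := by
    have h1 : D ^ 2 * (lam k * (T k - lam k)) = α' * β' * (e * E') ^ k := by
      calc D ^ 2 * (lam k * (T k - lam k)) = (D * lam k) * (D * (T k - lam k)) := by ring
        _ = (α' * e ^ k) * (β' * E' ^ k) := by rw [hlamclosed, hμclosed]
        _ = α' * β' * (e * E') ^ k := by rw [mul_pow]; ring
    rw [hquad k, hprod, pow_succ (-1 : ℝ) k] at h1
    have h2 : ((-1 : ℝ) ^ k) ≠ 0 := pow_ne_zero _ (by norm_num)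
    have h3 : (α' * β' + D ^ 2) * (-1) ^ k = 0 := by linarith
    rcases mul_eq_zero.1 h3 with h4 | h4
    · linarith
    · exact absurd h4 h2
  have hαβ' : α' * β' = a * T 0 * T 1 - T 1 ^ 2 + T 0 ^ 2 := by
    simp only [hα', hβ']
    linear_combination (T 0 * T 1) * hsum - (T 0) ^ 2 * hprod
  have hD2 : D ^ 2 = a ^ 2 + 4 := by
    simp only [hD]
    linear_combination (e + E' + a) * hsum - 4 * hprod
  rw [hαβ', hD2, hT0, hT1] at hαβ
  have hsq : ((a : ℝ) - b) ^ 2 = 0 := by linear_combination hαβ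
  have hab : (a : ℝ) - b = 0 := pow_eq_zero_iff (two_ne_zero) |>.1 hsq
  exact_mod_cast sub_eq_zero.1 hab

/-! ### The matrices `g_aᵏ g_b`: traces, denominators, periodic points -/

/-- `g_a² = a g_a + 1`. [folklore] -/
theorem cfGen_mul_self (a : ℕ) : cfGen a * cfGen a = (a : ℤ) • cfGen a + 1 := by
  ext i j
  fin_cases i <;> fin_cases j <;> (simp [cfGen, Matrix.mul_apply, Fin.sum_univ_two]; try ring)

/-- The matrices `N_k = g_aᵏ g_b`. [folklore] -/
def cfNab (a b k : ℕ) : Matrix (Fin 2) (Fin 2) ℤ := cfGen a ^ k * cfGen b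

/-- The recurrence `N_{k+2} = a N_{k+1} + N_k`. [folklore] -/
theorem cfNab_add_two (a b k : ℕ) : cfNab a b (k + 2) = (a : ℤ) • cfNab a b (k + 1) + cfNab a b k := by
  have h : cfGen a ^ (k + 2) = cfGen a ^ k * (cfGen a * cfGen a) := by rw [pow_add, sq]
  rw [cfNab, cfNab, cfNab, h, cfGen_mul_self, Matrix.mul_add, Matrix.mul_smul, Matrix.mul_one,
    Matrix.add_mul, Matrix.smul_mul, pow_succ]

/-- `det N_k = (-1)^{k+1}`. [folklore] -/
theorem det_cfNab (a b k : ℕ) : (cfNab a b k).det = (-1) ^ (k + 1) := by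
  rw [cfNab, Matrix.det_mul, Matrix.det_pow, det_cfGen, det_cfGen, pow_succ]

/-- The traces `T_k = tr N_k`. [folklore] -/
def cfTab (a b k : ℕ) : ℤ := cfNab a b k 0 0 + cfNab a b k 1 1

/-- `T_{k+2} = a T_{k+1} + T_k`. [folklore] -/
theorem cfTab_add_two (a b k : ℕ) : cfTab a b (k + 2) = a * cfTab a b (k + 1) + cfTab a b k := by
  simp only [cfTab, cfNab_add_two, Matrix.add_apply, Matrix.smul_apply, smul_eq_mul]
  ring

/-- `T_0 = b`. [folklore] -/
theorem cfTab_zero (a b : ℕ) : cfTab a b 0 = b := by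
  simp [cfTab, cfNab, cfGen]

/-- `T_1 = ab + 2`. [folklore] -/
theorem cfTab_one (a b : ℕ) : cfTab a b 1 = a * b + 2 := by
  simp [cfTab, cfNab, cfGen, Matrix.mul_apply, Fin.sum_univ_two]
  ring

/-- The denominators `q_k = (N_k)₁₁` satisfy `q_{k+2} = a q_{k+1} + q_k`. [folklore] -/
theorem cfNab_one_one_add_two (a b k : ℕ) :
    cfNab a b (k + 2) 1 1 = a * cfNab a b (k + 1) 1 1 + cfNab a b k 1 1 := by
  simp only [cfNab_add_two, Matrix.add_apply, Matrix.smul_apply, smul_eq_mul]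

/-- `q_0 = b`. [folklore] -/
theorem cfNab_one_one_zero (a b : ℕ) : cfNab a b 0 1 1 = b := by
  simp [cfNab, cfGen]

/-- `q_1 = ab + 1`. [folklore] -/
theorem cfNab_one_one_one (a b : ℕ) : cfNab a b 1 1 1 = a * b + 1 := by
  simp [cfNab, cfGen, Matrix.mul_apply, Fin.sum_univ_two]
  ring

/-- Powers of a generator as word matrices: `M_k(a, a, …) = g_aᵏ`. [folklore] -/
theorem cfWord_const (a : ℕ) : ∀ k, cfWord (fun _ => a) k = cfGen a ^ k
  | 0 => by simp
  | k + 1 => by rw [cfWord_succ, cfWord_const a k, pow_succ]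

/-- The periodic digit sequence `a, …, a, b, a, …, a, b, …` (period `k+1`). [folklore] -/
def cfPab (a b k : ℕ) : ℕ → ℕ := fun i => if i % (k + 1) < k then a else b

/-- Periodicity. [folklore] -/
theorem cfPab_add (a b k i : ℕ) : cfPab a b k (i + (k + 1)) = cfPab a b k i := by
  simp [cfPab, Nat.add_mod_right]

/-- The digits lie in `A`. [folklore] -/
theorem cfPab_mem {a b : ℕ} (ha : a ∈ A) (hb : b ∈ A) (k i : ℕ) : cfPab a b k i ∈ A := by
  unfold cfPab
  split_ifs
  · exact ha
  · exact hb

/-- `M_{k+1}(a,…,a,b,…) = g_aᵏ g_b`. [folklore] -/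
theorem cfWord_cfPab (a b k : ℕ) : cfWord (cfPab a b k) (k + 1) = cfNab a b k := by
  rw [cfWord_succ, cfNab]
  congr 1
  · rw [← cfWord_const a k]
    exact cfWord_congr fun i hi => by
      simp [cfPab, Nat.mod_eq_of_lt (Nat.lt_succ_of_lt hi), hi]
  · simp [cfPab, Nat.mod_eq_of_lt (Nat.lt_succ_self k)]

/-- The periodic point `x_k = [0; a,…,a,b, a,…,a,b, …]` is fixed by `N_k`. [folklore] -/
theorem cfMoeb_cfNab_cfValue {a b : ℕ} (ha : 1 ≤ a) (hb : 1 ≤ b) (k : ℕ) :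
    cfMoeb (cfNab a b k) (cfValue (cfPab a b k)) = cfValue (cfPab a b k) := by
  have hd : ∀ i, 1 ≤ cfPab a b k i := fun i => by
    unfold cfPab; split_ifs <;> assumption
  have h := cfValue_eq_cfMoeb_cfWord hd (k + 1)
  have hs : (fun i => cfPab a b k (i + (k + 1))) = cfPab a b k := funext (cfPab_add a b k)
  rw [hs, cfWord_cfPab] at h
  exact h.symm

/-- The fixed point of `g_a`: `x_a = [0; a, a, …]`, `g_a x_a = x_a`. [folklore] -/
theorem cfMoeb_cfGen_cfValue {a : ℕ} (ha : 1 ≤ a) :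
    cfMoeb (cfGen a) (cfValue fun _ => a) = cfValue fun _ => a := by
  have h := cfValue_eq_cfMoeb_cfWord (d := fun _ => a) (fun _ => ha) 1
  rw [cfWord_succ, cfWord_zero, one_mul] at h
  exact h.symm

/-! ### The non-lattice theorem -/

section Main

variable (hA : ∀ a ∈ A, 1 ≤ a)
include hA

/-- **Aperiodicity of `L_s` on the critical lines** ([MageeOhWinter2019, §4.1–4.2], after Naud and
Lalley; the non-lattice property of `Γ_A`): if `A` contains two distinct letters, `σ ≥ 0`,
`t ≠ 0`, `|ω| = 1`, and `w` is continuous on `[0,1]` with `L_{σ+it} w = ω e^{P_A(σ)} w` on `[0,1]`,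
then `w = 0` on `[0,1]`. In particular `L_{δ+it}` (`t ≠ 0`) has no eigenvalue of modulus `1` on
continuous functions. [cite: MageeOhWinter2019, Thm. 4] -/
theorem cfLC_eigenfunction_eq_zero (hab : ∃ a ∈ A, ∃ b ∈ A, a ≠ b) {σ : ℝ} (hσ : 0 ≤ σ)
    {t : ℝ} (ht : t ≠ 0) {ω : ℂ} (hω : ‖ω‖ = 1) {w : ℝ → ℂ} (hw : ContinuousOn w (Icc 0 1))
    (heig : ∀ x ∈ Icc (0 : ℝ) 1,
      cfLC A ((σ : ℂ) + t * Complex.I) w x = ω * (cfEig A σ : ℂ) * w x) :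
    ∀ x ∈ Icc (0 : ℝ) 1, w x = 0 := by
  obtain ⟨a, ha, b, hb, hab⟩ := hab
  have hne : A.Nonempty := ⟨a, ha⟩
  have ha1 : 1 ≤ a := hA a ha
  have hb1 : 1 ≤ b := hA b hb
  obtain ⟨h, hbd, hlip, heigh⟩ := exists_cfTransfer_eigenfunction hA hne hσ
  have hpos : ∀ x ∈ Icc (0 : ℝ) 1, 0 < h x := fun x hx =>
    lt_of_lt_of_le (Real.rpow_pos_of_pos (by norm_num) _) (hbd x hx).1
  have hcont : ContinuousOn h (Icc 0 1) := by
    have hL : LipschitzOnWith ((4 : ℝ) ^ σ * (2 * σ * Real.exp (2 * σ))).toNNReal h (Icc 0 1) := by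
      refine LipschitzOnWith.of_dist_le_mul fun x hx y hy => ?_
      rw [Real.dist_eq, Real.dist_eq]
      exact (hlip x hx y hy).trans
        (mul_le_mul_of_nonneg_right (Real.le_coe_toNNReal _) (abs_nonneg _))
    exact hL.continuousOn
  obtain ⟨m, hm0, hle, hE⟩ :=
    cfLC_eigen_maxPrinciple hA (re_ofReal_add_mul_I σ t) hpos hcont heigh hw hω heig
  rcases hm0.eq_or_lt with hm | hm
  · intro x hx
    have h1 := hle x hx
    rw [← hm, zero_mul] at h1
    exact norm_le_zero_iff.1 h1
  exfalso
  -- the fixed point of `g_a`: `e = x_a + a`, `e² = a e + 1`, `e > 1`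
  set xa : ℝ := cfValue fun _ => a with hxa
  have hxafix : cfMoeb (cfGen a) xa = xa := cfMoeb_cfGen_cfValue ha1
  have hxapos : 0 < xa := cfValue_pos fun _ => ha1
  set e : ℝ := cfDenom (cfGen a) xa with hedef
  have he_eq : e = xa + a := cfDenom_cfGen a xa
  have ha1' : (1 : ℝ) ≤ a := by exact_mod_cast ha1
  have he1 : 1 < e := by rw [he_eq]; linarith
  have he0 : 0 < e := by linarith
  have hee : e ^ 2 = a * e + 1 := by
    have h1 : xa * (xa + a) = 1 := by
      have h2 := hxafix
      rw [cfMoeb_cfGen] at h2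
      have h3 : xa + a ≠ 0 := by linarith
      field_simp at h2
      linarith
    rw [he_eq]
    nlinarith [h1]
  -- the periodic points `x_k` of `N_k = g_aᵏ g_b` and `λ_k = denom(N_k, x_k)`
  set xk : ℕ → ℝ := fun k => cfValue (cfPab a b k) with hxk
  have hdk : ∀ k i, 1 ≤ cfPab a b k i := fun k i => hA _ (cfPab_mem ha hb k i)
  have hxkI : ∀ k, xk k ∈ Icc (0 : ℝ) 1 := fun k => cfValue_mem_Icc (hdk k)
  have hxkfix : ∀ k, cfMoeb (cfNab a b k) (xk k) = xk k := fun k => cfMoeb_cfNab_cfValue ha1 hb1 k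
  set lam : ℕ → ℝ := fun k => cfDenom (cfNab a b k) (xk k) with hlam
  -- `λ_k ∈ [q_k, 2 q_k]`, `q_k = (N_k)₁₁`
  have hlam_mem : ∀ k, (cfNab a b k 1 1 : ℝ) ≤ lam k ∧ lam k ≤ 2 * (cfNab a b k 1 1 : ℝ) := by
    intro k
    have hmat : cfMat (fun i : Fin (k + 1) => cfPab a b k i) = cfNab a b k := by
      rw [← cfWord_cfPab]
      exact cfWord_congr fun i hi => by rw [cfExt_of_lt _ hi]
    have h1 := cfDenom_cfMat_mem (w := fun i : Fin (k + 1) => cfPab a b k i) (fun i => hdk k i) (hxkI k)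
    rw [hmat] at h1
    have hq : ((cfQ fun i : Fin (k + 1) => cfPab a b k i : ℤ) : ℝ) = (cfNab a b k 1 1 : ℝ) := by
      rw [cfQ_eq, hmat]
    rw [hq] at h1
    exact h1
  have hq1 : ∀ k, (1 : ℝ) ≤ (cfNab a b k 1 1 : ℝ) := by
    intro k
    have hmat : cfMat (fun i : Fin (k + 1) => cfPab a b k i) = cfNab a b k := by
      rw [← cfWord_cfPab]
      exact cfWord_congr fun i hi => by rw [cfExt_of_lt _ hi]
    have h1 : (1 : ℤ) ≤ cfQ fun i : Fin (k + 1) => cfPab a b k i := one_le_cfQ fun i => hdk k i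
    rw [cfQ_eq, hmat] at h1
    exact_mod_cast h1
  have hlam_pos : ∀ k, 0 < lam k := fun k => lt_of_lt_of_le one_pos ((hq1 k).trans (hlam_mem k).1)
  -- the eigenvalue equations `λ_k (T_k - λ_k) = (-1)^{k+1}`
  have hquad : ∀ k, lam k * ((cfTab a b k : ℝ) - lam k) = (-1) ^ (k + 1) := by
    intro k
    have h1 := cfDenom_sq_sub_of_fixed (cfNab a b k) (hlam_pos k).ne' (hxkfix k)
    have hdet : ((cfNab a b k 0 0 : ℝ) * cfNab a b k 1 1 - (cfNab a b k 0 1 : ℝ) * cfNab a b k 1 0) =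
        (-1) ^ (k + 1) := by
      have h2 := det_cfNab a b k
      rw [Matrix.det_fin_two] at h2
      exact_mod_cast h2
    rw [hdet] at h1
    have hT : (cfTab a b k : ℝ) = (cfNab a b k 0 0 : ℝ) + cfNab a b k 1 1 := by
      simp [cfTab]
    rw [hT]
    simp only [hlam] at h1 ⊢
    linarith
  -- growth bounds for `q_k`, hence boundedness of `d_k = log λ_k - k log e - log λ_0`
  obtain ⟨c, C, hc, hC, hqb⟩ := cf_twoStep_bounds (Q := fun k => (cfNab a b k 1 1 : ℝ)) he0 hee
    (fun k => by simp [cfNab_one_one_add_two])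
    (by rw [cfNab_one_one_zero]; exact_mod_cast lt_of_lt_of_le one_pos hb1)
    (by rw [cfNab_one_one_one]; push_cast; positivity)
  set dk : ℕ → ℝ := fun k => Real.log (lam k) - k * Real.log e - Real.log (lam 0) with hdk_def
  have hdk_bd : ∀ k, |dk k| ≤ |Real.log c| + |Real.log (2 * C)| + |Real.log (lam 0)| := by
    intro k
    have h1 : c * e ^ k ≤ lam k := (hqb k).1.trans (hlam_mem k).1
    have h2 : lam k ≤ 2 * C * e ^ k := by
      have := (hqb k).2; have := (hlam_mem k).2; nlinarith
    have hek : 0 < e ^ k := pow_pos he0 k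
    have hl1 := Real.log_le_log (by positivity) h1
    have hl2 := Real.log_le_log (hlam_pos k) h2
    rw [Real.log_mul hc.ne' hek.ne', Real.log_pow] at hl1
    rw [Real.log_mul (by positivity) hek.ne', Real.log_pow] at hl2
    simp only [hdk_def]
    have e1 : |Real.log c| ≥ -Real.log c := neg_le_abs _
    have e2 : |Real.log (2 * C)| ≥ Real.log (2 * C) := le_abs_self _
    have e3 := neg_abs_le (Real.log (lam 0))
    have e4 := le_abs_self (Real.log (lam 0))
    have e5 := abs_nonneg (Real.log c)
    have e6 := abs_nonneg (Real.log (2 * C))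
    rw [abs_le]
    constructor <;> linarith
  -- the phases: `wt_{it}(N_k, x_k) = ω^{k+1}`, `wt_{it}(g_a, x_a) = ω`
  have hphase : ∀ k, cfWt (t * Complex.I) (cfNab a b k) (xk k) = ω ^ (k + 1) := by
    intro k
    rw [← cfWord_cfPab]
    refine cfLC_eigen_phase_periodic hA hpos heigh hω heig hm hE
      (fun i => cfPab_mem ha hb k i) (n := k + 1) (x := xk k) rfl ?_
    rw [cfWord_cfPab]
    exact hxkfix k
  have hphase_a : cfWt (t * Complex.I) (cfGen a) xa = ω := by
    have h1 := cfLC_eigen_phase_periodic hA hpos heigh hω heig hm hE (d := fun _ => a)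
      (fun _ => ha) (n := 1) (x := xa) rfl (by rw [cfWord_succ, cfWord_zero, one_mul]; exact hxafix)
    rwa [cfWord_succ, cfWord_zero, one_mul, pow_one] at h1
  -- `exp(-2it d_k) = 1`, so `d_k ∈ -(π/t) ℤ`
  have hω0 : ω ≠ 0 := fun h0 => by rw [h0, norm_zero] at hω; exact zero_ne_one hω
  have hexp : ∀ k, Complex.exp (-(2 * (t * Complex.I) * (dk k : ℂ))) = 1 := by
    intro k
    have h1 : Complex.exp (-(2 * (t * Complex.I) * (Real.log (lam k) : ℂ))) = ω ^ (k + 1) :=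
      hphase k
    have h0 : Complex.exp (-(2 * (t * Complex.I) * (Real.log (lam 0) : ℂ))) = ω := by
      have h0' : Complex.exp (-(2 * (t * Complex.I) * (Real.log (lam 0) : ℂ))) = ω ^ (0 + 1) :=
        hphase 0
      rwa [zero_add, pow_one] at h0'
    have ha' : Complex.exp (-(2 * (t * Complex.I) * (Real.log e : ℂ))) = ω := hphase_a
    have hk : Complex.exp (-(2 * (t * Complex.I) * ((k * Real.log e : ℝ) : ℂ))) = ω ^ k := by
      rw [← ha', ← Complex.exp_nat_mul]
      congr 1
      push_cast
      ring
    have e1 : (-(2 * (t * Complex.I) * (dk k : ℂ))) =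
        (-(2 * (t * Complex.I) * (Real.log (lam k) : ℂ))) -
          (-(2 * (t * Complex.I) * ((k * Real.log e : ℝ) : ℂ))) -
          (-(2 * (t * Complex.I) * (Real.log (lam 0) : ℂ))) := by
      simp only [hdk_def]
      push_cast
      ring
    rw [e1, Complex.exp_sub, Complex.exp_sub, h1, hk, h0, div_div, ← pow_succ,
      div_self (pow_ne_zero _ hω0)]
  have hex : ∀ k, ∃ N : ℤ, dk k = -(Real.pi * N) / t := by
    intro k
    obtain ⟨N, hN⟩ := Complex.exp_eq_one_iff.1 (hexp k)
    refine ⟨N, ?_⟩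
    have e2 : (((-(2 * t * dk k)) : ℝ) : ℂ) * Complex.I =
        ((((N : ℝ) * (2 * Real.pi)) : ℝ) : ℂ) * Complex.I := by
      push_cast
      calc -(2 * (t : ℂ) * (dk k : ℂ)) * Complex.I = -(2 * (t * Complex.I) * (dk k : ℂ)) := by ring
        _ = (N : ℂ) * (2 * Real.pi * Complex.I) := hN
        _ = (N : ℂ) * (2 * Real.pi) * Complex.I := by ring
    have e3 := mul_right_cancel₀ Complex.I_ne_zero e2
    have e4 : -(2 * t * dk k) = (N : ℝ) * (2 * Real.pi) := by exact_mod_cast e3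
    field_simp
    linarith
  choose N hN using hex
  -- the integers `N_k` are bounded, hence two of them coincide
  set B : ℝ := |Real.log c| + |Real.log (2 * C)| + |Real.log (lam 0)| with hB
  have hNbd : ∀ k, |(N k : ℝ)| ≤ B * |t| / Real.pi := by
    intro k
    have h1 := hdk_bd k
    rw [hN k] at h1
    rw [le_div_iff₀ Real.pi_pos]
    have h2 : |(-(Real.pi * N k) / t)| = Real.pi * |(N k : ℝ)| / |t| := by
      rw [abs_div, abs_neg, abs_mul, abs_of_pos Real.pi_pos]
    rw [h2, div_le_iff₀ (abs_pos.2 ht)] at h1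
    linarith
  obtain ⟨k₁, -, k₂, -, hk12, hNeq⟩ : ∃ k₁ ∈ (Set.univ : Set ℕ), ∃ k₂ ∈ (Set.univ : Set ℕ),
      k₁ ≠ k₂ ∧ N k₁ = N k₂ := by
    refine Set.infinite_univ.exists_ne_map_eq_of_mapsTo (f := N)
      (t := Set.Icc (-⌈B * |t| / Real.pi⌉) ⌈B * |t| / Real.pi⌉) (fun k _ => ?_) (Set.finite_Icc _ _)
    have h1 := abs_le.1 (hNbd k)
    constructor
    · have : (-⌈B * |t| / Real.pi⌉ : ℝ) ≤ N k := by linarith [Int.le_ceil (B * |t| / Real.pi)]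
      exact_mod_cast this
    · have : (N k : ℝ) ≤ ⌈B * |t| / Real.pi⌉ := h1.2.trans (Int.le_ceil _)
      exact_mod_cast this
  have hdeq : dk k₁ = dk k₂ := by rw [hN k₁, hN k₂, hNeq]
  -- WLOG `k₁ < k₂`; then `λ_{k₂} = e^{k₂ - k₁} λ_{k₁}`
  have key : ∀ {k k' : ℕ}, k < k' → dk k = dk k' → lam k' = e ^ (k' - k) * lam k := by
    intro k k' hkk' hd
    obtain ⟨m', rfl⟩ := Nat.exists_eq_add_of_lt hkk'
    have hm' : k + m' + 1 - k = m' + 1 := by omega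
    rw [hm']
    simp only [hdk_def] at hd
    have h1 : Real.log (lam (k + m' + 1)) = Real.log (lam k) + (m' + 1 : ℕ) * Real.log e := by
      push_cast at hd ⊢
      linarith
    calc lam (k + m' + 1) = Real.exp (Real.log (lam (k + m' + 1))) := (Real.exp_log (hlam_pos _)).symm
      _ = Real.exp (Real.log (lam k) + (m' + 1 : ℕ) * Real.log e) := by rw [h1]
      _ = e ^ (m' + 1) * lam k := by
          rw [Real.exp_add, Real.exp_log (hlam_pos _), ← Real.log_pow, Real.exp_log (pow_pos he0 _)]
          ring
  have hTrec : ∀ k, (cfTab a b (k + 2) : ℝ) = a * (cfTab a b (k + 1) : ℝ) + (cfTab a b k : ℝ) := by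
    intro k; simp [cfTab_add_two]
  have hT0 : (cfTab a b 0 : ℝ) = b := by simp [cfTab_zero]
  have hT1 : (cfTab a b 1 : ℝ) = a * b + 2 := by simp [cfTab_one]
  rcases lt_or_gt_of_ne hk12 with hlt | hlt
  · have hrel := key hlt hdeq
    obtain ⟨m', rfl⟩ := Nat.exists_eq_add_of_lt hlt
    have hm'' : k₁ + m' + 1 - k₁ = m' + 1 := by omega
    rw [hm''] at hrel
    rw [show k₁ + m' + 1 = k₁ + (m' + 1) by ring] at hrel
    exact hab (cf_nonlattice_core (T := fun k => (cfTab a b k : ℝ)) (lam := lam) he1 hee hT0 hT1 hTrec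
      hquad (by omega) hrel)
  · have hrel := key hlt hdeq.symm
    obtain ⟨m', rfl⟩ := Nat.exists_eq_add_of_lt hlt
    have hm'' : k₂ + m' + 1 - k₂ = m' + 1 := by omega
    rw [hm''] at hrel
    rw [show k₂ + m' + 1 = k₂ + (m' + 1) by ring] at hrel
    exact hab (cf_nonlattice_core (T := fun k => (cfTab a b k : ℝ)) (lam := lam) he1 hee hT0 hT1 hTrec
      hquad (by omega) hrel)

end Main

end Literature.NumberTheory.Sieve
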